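import Mathlib.Analysis.SpecialFunctions.Pow.Real
import Mathlib.Analysis.SpecialFunctions.Log.Basic
import HarnessLib

/-!
# Inflation-rule arithmetic for the downfolded box: power-law sensitivities (INFL-P) and the
# filling interval (INFL-dop)

Venture CertifiedManyBodySolver, cell `pub/hubbard-downfold` (stage S1 = downfolding front end),
seat hubbard-downfold-mod-2; namespace `Summit.Ventures.CertifiedManyBodySolver.Downfold.Inflation`.
Everything here is PROVED (elementary real analysis from Mathlib). WHAT THIS IS NOT: a physical law —
the power-law scalings `X ∝ d^{-η}` (Harrison) and the charge-counting rule are MODELLING inputs of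
`pub/hubbard-downfold/router/INFLATION-RULES.md` §P/§dop; this file only certifies the interval
bookkeeping those rules print.

* `abs_log_rpow_div_le` — if `|log (d/d₀)| ≤ Δ` then `|log ((d₀/d)^η)| ≤ |η|·Δ`: a bond-length
  mismatch of `Δ` in log moves a power-law coupling by at most `|η| Δ` in log (§P.1).
* `abs_log_sq_div_le` — exponents of `A²/B` add: `|log (A²/B)| ≤ 2|log A| + |log B|` (one-band
  `t ≈ t_pd²/Δ_pd`, §P.2).
* Printing a multiplicative width `e^{±s}` as the schema's additive `−w₋/+w₊` uses
  `e^s − 1 ≤ s + s²` (`0 ≤ s ≤ 1`) and `1 − e^{−s} ≤ s` (§P.0); both are ALREADY in the tree: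
  `Literature.Computability.QuantumComplexity.exp_sub_one_le_add_sq`,
  `Literature.NumberTheory.LFunctions.PrimeReciprocal.one_sub_exp_neg_le` (not re-proved here).
* `filling_mem_Icc` — `n = 1 − x − 2δ + e` with `x ∈ [x₋,x₊]`, `δ ∈ [δ₋,δ₊]`, `|e| ≤ γ` lies in
  `[1 − x₊ − 2δ₊ − γ, 1 − x₋ − 2δ₋ + γ]` (§dop D.2).
-/

namespace Summit.Ventures.CertifiedManyBodySolver.Downfold.Inflation

open Real

/-- **Power-law sensitivity (INFL-P §P.1).** For positive bond lengths `d, d₀` with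
`|log (d / d₀)| ≤ Δ`, the power law `(d₀ / d) ^ η` deviates from `1` by at most `|η| Δ` in log.
[folklore] -/
theorem abs_log_rpow_div_le {d d₀ η Δ : ℝ} (hd : 0 < d) (hd₀ : 0 < d₀)
    (h : |Real.log (d / d₀)| ≤ Δ) : |Real.log ((d₀ / d) ^ η)| ≤ |η| * Δ := by
  have hq : 0 < d₀ / d := div_pos hd₀ hd
  rw [Real.log_rpow hq, abs_mul]
  have hinv : Real.log (d₀ / d) = -Real.log (d / d₀) := by
    rw [← Real.log_inv, inv_div]
  rw [hinv, abs_neg]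
  exact mul_le_mul_of_nonneg_left h (abs_nonneg η)

/-- The same with the coupling written out: `X = X₀ · (d₀/d)^η`, `X₀ > 0` ⇒
`|log (X / X₀)| ≤ |η| Δ`. [folklore] -/
theorem abs_log_div_le_of_powerlaw {X X₀ d d₀ η Δ : ℝ} (hX₀ : 0 < X₀) (hd : 0 < d) (hd₀ : 0 < d₀)
    (hX : X = X₀ * (d₀ / d) ^ η) (h : |Real.log (d / d₀)| ≤ Δ) :
    |Real.log (X / X₀)| ≤ |η| * Δ := by
  have : X / X₀ = (d₀ / d) ^ η := by
    rw [hX, mul_comm, mul_div_assoc, div_self hX₀.ne', mul_one]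
  rw [this]
  exact abs_log_rpow_div_le hd hd₀ h

/-- **Exponents add (INFL-P §P.2)**: `|log (A² / B)| ≤ 2 |log A| + |log B|` for `A, B > 0`
(one-band `t ≈ t_pd² / Δ_pd`). [folklore] -/
theorem abs_log_sq_div_le {A B : ℝ} (hA : 0 < A) (hB : 0 < B) :
    |Real.log (A ^ 2 / B)| ≤ 2 * |Real.log A| + |Real.log B| := by
  rw [Real.log_div (pow_pos hA 2).ne' hB.ne', Real.log_pow, Nat.cast_ofNat]
  calc |2 * Real.log A - Real.log B| ≤ |2 * Real.log A| + |Real.log B| := abs_sub _ _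
    _ = 2 * |Real.log A| + |Real.log B| := by rw [abs_mul, abs_two]

/-- **The filling interval (INFL-dop §D.2)**: with `x ∈ [x₋, x₊]`, `δ ∈ [δ₋, δ₊]` and a treatment
discrepancy `|e| ≤ γ`, the filling `n = 1 − x − 2δ + e` lies in
`[1 − x₊ − 2δ₊ − γ, 1 − x₋ − 2δ₋ + γ]`. [folklore] -/
theorem filling_mem_Icc {x xlo xhi δ δlo δhi e γ : ℝ} (hx : x ∈ Set.Icc xlo xhi)
    (hδ : δ ∈ Set.Icc δlo δhi) (he : |e| ≤ γ) :
    1 - x - 2 * δ + e ∈ Set.Icc (1 - xhi - 2 * δhi - γ) (1 - xlo - 2 * δlo + γ) := by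
  obtain ⟨hx1, hx2⟩ := hx
  obtain ⟨hδ1, hδ2⟩ := hδ
  obtain ⟨he1, he2⟩ := abs_le.1 he
  constructor <;> linarith

/-! ### Two axes, one measured constraint: the worst-partition lever bound (§P.5b(H′), §P.11 step 2′) -/

/-- **One measured pair bounds every partition.** Unknown non-negative per-axis levers `ηa, ηc`
constrained by ONE measured response `ηa * A + ηc * C = T` (the material's own pair: in-plane
log-strain `A > 0`, axial `C > 0`, total log-response `T ≥ 0`) cost at most
`T * max (x / A) (y / C)` on any other non-negative partition `(x, y)` of a mismatch — the linear
form is maximised at a vertex of the constraint segment (all-in-plane `ηa = T/A` or all-axial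
`ηc = T/C`). Used to price a comparator-band corner with MEASURED levers instead of table values
(Hg-1223 @15: `A = 0.031`, `C = 0.069`, `T = 0.139` from Hg1201's pair; corner `x = 0.012`,
`y = 0.016` ⇒ `≤ 0.139 · max (0.387, 0.232) = 0.054`). [folklore] -/
theorem lever_cost_le_of_constraint {ηa ηc A C T x y : ℝ} (hA : 0 < A) (hC : 0 < C)
    (ha : 0 ≤ ηa) (hc : 0 ≤ ηc) (hcon : ηa * A + ηc * C = T) :
    ηa * x + ηc * y ≤ T * max (x / A) (y / C) := by
  have hM1 : x / A ≤ max (x / A) (y / C) := le_max_left _ _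
  have hM2 : y / C ≤ max (x / A) (y / C) := le_max_right _ _
  have e1 : ηa * x = ηa * A * (x / A) := by field_simp
  have e2 : ηc * y = ηc * C * (y / C) := by field_simp
  have h1 : ηa * A * (x / A) ≤ ηa * A * max (x / A) (y / C) :=
    mul_le_mul_of_nonneg_left hM1 (mul_nonneg ha hA.le)
  have h2 : ηc * C * (y / C) ≤ ηc * C * max (x / A) (y / C) :=
    mul_le_mul_of_nonneg_left hM2 (mul_nonneg hc hC.le)
  calc ηa * x + ηc * y = ηa * A * (x / A) + ηc * C * (y / C) := by rw [e1, e2]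
    _ ≤ ηa * A * max (x / A) (y / C) + ηc * C * max (x / A) (y / C) := add_le_add h1 h2
    _ = T * max (x / A) (y / C) := by rw [← add_mul, hcon]

/-- **The bound is attained** at the all-in-plane vertex: with `ηa = T / A`, `ηc = 0` the
constraint holds and the cost on `(x, y)` is exactly `T * (x / A)` — so
`lever_cost_le_of_constraint` is sharp when `x / A ≥ y / C` (mirror vertex otherwise), not merely an
envelope. [folklore] -/
theorem lever_cost_vertex_inplane {A C T x y : ℝ} (hA : 0 < A) :
    (T / A) * A + 0 * C = T ∧ (T / A) * x + 0 * y = T * (x / A) := by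
  have e : T / A * A = T := by field_simp
  constructor
  · rw [e]; ring
  · rw [zero_mul, add_zero, div_mul_eq_mul_div, mul_div_assoc]

/-! ### Interval comparator: the far-edge rule (§P.11 step 2″) -/

/-- **FAR-EDGE RULE.** When the printed comparator volume is an INTERVAL `[Vlo, Vhi]` (a source
hull, an EOS-parameter band, or `κ_V`-interval × P), the structure mismatch that INFL-P must cover
for EVERY admissible true cell `V ∈ [Vlo, Vhi]` is `|log (Vdft / V)| ≤ max |log (Vdft / Vlo)|
|log (Vdft / Vhi)|` — the FAR edge, whether `Vdft` lies inside the hull or not (Hg-1223 #35: @15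
`Vdft = 211.73` above the hull `[201.1, 208.8]` ⇒ 0.051; @30 `192.44 ∈ [183.2, 195.3]` ⇒ 0.049).
[folklore] -/
theorem abs_log_div_le_max_of_mem_Icc {Vdft Vlo Vhi V : ℝ} (hd : 0 < Vdft) (hlo : 0 < Vlo)
    (hV : V ∈ Set.Icc Vlo Vhi) :
    |log (Vdft / V)| ≤ max |log (Vdft / Vlo)| |log (Vdft / Vhi)| := by
  have hVpos : 0 < V := lt_of_lt_of_le hlo hV.1
  have hhi : 0 < Vhi := lt_of_lt_of_le hVpos hV.2
  rw [log_div hd.ne' hVpos.ne', log_div hd.ne' hlo.ne', log_div hd.ne' hhi.ne']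
  -- log Vdft - log Vhi ≤ log Vdft - log V ≤ log Vdft - log Vlo
  have h1 : log Vdft - log Vhi ≤ log Vdft - log V :=
    sub_le_sub_left (log_le_log hVpos hV.2) _
  have h2 : log Vdft - log V ≤ log Vdft - log Vlo :=
    sub_le_sub_left (log_le_log hlo hV.1) _
  rw [max_comm]
  exact abs_le_max_abs_abs h1 h2

/-- The far-edge bound is ATTAINED at an end point (take `V = Vlo` or `V = Vhi`), so the rule is the
exact supremum, not an over-estimate; and the composed INFL-P pad `S * Δ` with
`Δ = max 0.03 (far edge)` dominates `S * |log (Vdft / V)|` for every admissible `V` when `0 ≤ S`.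
[folklore] -/
theorem mul_abs_log_div_le_pad {S Vdft Vlo Vhi V floor : ℝ} (hS : 0 ≤ S) (hd : 0 < Vdft)
    (hlo : 0 < Vlo) (hV : V ∈ Set.Icc Vlo Vhi) :
    S * |log (Vdft / V)| ≤ S * max floor (max |log (Vdft / Vlo)| |log (Vdft / Vhi)|) :=
  mul_le_mul_of_nonneg_left
    ((abs_log_div_le_max_of_mem_Icc hd hlo hV).trans (le_max_right _ _)) hS


end Summit.Ventures.CertifiedManyBodySolver.Downfold.Inflation
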